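import Summits.ResolutionOfSingularities.ResolutionOfSingularities.Theorems.EquisingularLiftEquisingularLiftNatConeDeltaPlaneChartsPresentation
import Summits.ResolutionOfSingularities.ResolutionOfSingularities.Theorems.EquisingularLiftEquisingularLiftNatConeFormRegroup
import Summits.ResolutionOfSingularities.ResolutionOfSingularities.Theorems.EquisingularLiftEquisingularLiftNatCarrierDeltaOfPresentation
import Summits.ResolutionOfSingularities.ResolutionOfSingularities.Theorems.EquisingularLiftEquisingularLiftNatCarrierDeltaFrameAdapted
import Summits.ResolutionOfSingularities.ResolutionOfSingularities.Theorems.EquisingularLiftEquisingularLiftNatSubchainSupplierInvDefs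
import Literature.AlgebraicGeometry.Resolution.WeightedInitialTerms
import HarnessLib

/-!
# [OURS · L1 W4.5(b) · EL♮(3)] B6c ★ T-PKG-FRAME: the `TCPlus.CentredPackage` at the cone point `p_c` of the stage `X₁`, assembled from the
# chart-0 presentation of `𝒪_{X₁,p_c}` (B6a), the axis section (B6b), the centred cone form (B4a) and the cone-delta transport (B7)
# (crux `EquisingularLiftNatThree` stmt-ResolutionOfSingularities-20148 / parent 20038; rung v7 TC⁺, brick `inv_base`, B8's clause (vi))

NOT a statement of any manuscript. Helper file of the chain res-L1-w45b (cell `res-hironaka`, LADDER-RESOLUTION rung L, slot W4.5(b));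
OURS; AI-written, weaker than expert review; `--supports stmt-ResolutionOfSingularities-20148 --as helper` by res-L1-w45b-stub-3 (object B6c ★
T-PKG-FRAME, res-L1-w45b-plan-1 BOOKING 2026-08-27T14:59:15Z on res-type-100's B6 SPLIT 14:56:25Z). No `sorry`; standard axioms. It closes nothing.

WHAT. res-L1-w45b-stub-1's `TCPlus.CentredPackage O P q X σ 𝓢 K p` (…NatSubchainSupplierInvDefs, p532383) asks, at the `O`-point `p` of the
stage `X`: a section `s` through `p` with `𝓢 ⊔ K ≤ ker s`, a frame `c` of `(ker s)_p` (quasi-regular, `𝒪_p/(c)` a domain, tail quasi-regular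
mod `c₀`) with `𝓢_p = (c₀)`, and a cone form `Φ` of degree `m ≥ 1` with `K_p = (Φ(c₁,c₂))`, `Φ mod (c) ≠ 0`, `Φ mod 𝔪 ≠ 0`,
`ConeDeltaRegular c Φ`. **`tcPlus_centredPackage_of_presentation`** supplies it for `X = X₁` (a blow-up `τ₁` of `X′` along `J`), `σ = τ₁ ≫ σ′`,
`𝓢 = J·𝒪_{X₁}`, `K = St_{τ₁} K₀`, `p = p₁` over `p ∈ supp J`, from:
* (B6a, res-type-100 `exists_conePoint_presentation` p541628) a quasi-regular frame `c` of `J_p` with `θR : 𝒪_p/(c) ≅ O` the identity on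
  constants and `(c) + (ι ϖ) = 𝔪_p`, and the chart-`0` presentation `χ₁ : 𝒪_p[c/c₀] → 𝒪_{X₁,p₁}` of the upstairs stalk at a prime `𝔔₁` over
  `𝔪_p` with `χ₁(c_l/c₀) ∈ 𝔪_{p₁}` (`l ≠ 0`);
* (B6b, res-D-pv-051 `exists_axisSection` p542434 — TAKE IT AT `C := C_axis ⊔ St K₀`, res-type-100 `axis_stalks` p542871 for the stalk) a section
  `s_c` of `X₁ → Spec O` through `p₁` with `J·𝒪_{X₁} ⊔ St K₀ ≤ ker s_c` and `(ker s_c)_{p₁} = (c₀/1, c₁/c₀, c₂/c₀)·𝒪_{p₁}`; `𝒪_{X₁,p₁}` regular of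
  dimension `3 + 1`;
* (B4a, res-type-100 `exists_centredConeLift_three` p540528) the centred form `Φ ∈ O[T₀,T₁,T₂]_d`: `1 ≤ m`, `∀ α ∈ supp Φ, m ≤ α₁ + α₂`, ONE
  exponent with `α₁ + α₂ = m` and unit coefficient (`hexact` — B4a's internal `∃ α ∈ supp g, α₁ + α₂ = m`), `ι_*Φ ≢ 0 mod (c)`, the germ
  `K₀_p = (ι_*Φ(c))`, and T-ΔLIFT-CENTRED's plane chart clauses `Φ(1,X,XY) = Xᵐ·Φu`, `Φ(1,XY,Y) = Yᵐ·Φv`, regular local rings of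
  `O[X,Y]/(Φu)`, `O[X,Y]/(Φv)` at primes containing `ϖ`;
* (B7, res-L1-w45b-stub-3 `coneDeltaRegular_of_chartPresentation` p540595; regrouping `exists_regroup_centred`, …NatConeFormRegroup).
The frame is `c′ = (χ₁(c₀/1), χ₁(c₁/c₀), χ₁(c₂/c₀))` (its clauses from res-type-100's `exists_sectionFrame_of_span_eq_forall_at`, p527425, and
res-L1-w45b-stub-2's `isQuasiRegular_tail_of_sup_span_singleton_eq`, p530905); `𝓢_{p₁} = (c′₀)`, `K_{p₁} = (χ₁ Φ(c/c₀))` by res-type-100's F2′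
`stalkIdeal_carrierDelta_of_presentation` (p535966); the cone form is the regrouping `Φ′` of `χ₁ Φ(1, c₁/c₀, c₂/c₀)`.

References: res-L1-w45b-stub-1 …NatSubchainSupplierInvDefs (p532383); res-type-100 p541628, p542871, p540528, p527425, p535966; res-D-pv-051 p542434;
res-L1-w45b-stub-2 p530905; res-L1-w45b-stub-3 p540595. H. Matsumura, *Commutative Ring Theory* (1986), Thm. 14.2 [cite: Matsumura1987].
-/

set_option linter.dupNamespace false -- mandated namespace `Summit.<Summit>.<Problem>` of this single-conjunct summit
set_option linter.overlappingInstances false -- signatures carry `[IsDomain O] [IsDiscreteValuationRing O]`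

noncomputable section

open CategoryTheory CategoryTheory.Limits AlgebraicGeometry TopologicalSpace IsLocalRing
open Literature.AlgebraicGeometry.Resolution
open AlgebraicGeometry.Scheme.IdealSheafData

namespace Summit.ResolutionOfSingularities.ResolutionOfSingularities.Cruxes.EquisingularLiftNat.Sections.TCPlus

/-- The span of a `Fin.cases` triple is the head singleton plus the span of the tail pair. [folklore] -/
theorem span_range_cases_three {A : Type*} [CommRing A] (a : A) (b : Fin 2 → A) :
    Ideal.span (Set.range fun i : Fin 3 => (Fin.cases a b i : A)) = Ideal.span {a} ⊔ Ideal.span {b 0, b 1} := by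
  rw [range_fin_three, ← Ideal.span_union, Set.singleton_union]
  rfl

set_option maxHeartbeats 800000 in -- chart algebra of a stalk = subalgebra of a localisation: slow instance unification (as p540528)
/-- **B6c ★ T-PKG-FRAME — the centred package at the cone point from the chart presentation, the axis section, the centred cone form and the
cone-delta transport.** See the module docstring for the inputs. [cite: Matsumura1987, Thm. 14.2] [OURS · L1 W4.5b] B6c for res-type-100's B8
`tcPlus_member_centred` (clause (vi)) / B9 `inv_base`; NOT a statement of the manuscript. -/
theorem tcPlus_centredPackage_of_presentation (O : Type) [CommRing O] [IsDomain O] [IsDiscreteValuationRing O] (ϖ : O) (hϖ : Irreducible ϖ)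
    (P : Scheme.{0}) (q : P ⟶ Spec (.of O)) {X' X₁ : Scheme.{0}} [IsLocallyNoetherian X₁] (σ' : X' ⟶ P)
    (r' : X' ⟶ Spec (.of O)) {J : X'.IdealSheafData} {τ₁ : X₁ ⟶ X'} [IsSeparated ((τ₁ ≫ σ') ≫ q)] (K₀ : X'.IdealSheafData)
    -- the cone point over the old centre, and the section frame there (B4a)
    (p₁ : X₁) (p : X') (hpc : τ₁ p₁ = p) (hpJ : p ∈ (J.support : Set X'))
    (c : Fin 3 → X'.presheaf.stalk p) (hcJ : Ideal.span (Set.range c) = stalkIdeal J p) (hc : IsQuasiRegular c)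
    (θR : (X'.presheaf.stalk p ⧸ Ideal.span (Set.range c)) ≃+* O)
    (hθR : ∀ b : O, θR (Ideal.Quotient.mk _
      (((Scheme.ΓSpecIso (.of O)).inv ≫ r'.appTop ≫ X'.presheaf.Γgerm p).hom b)) = b)
    (h𝔪R : Ideal.span (Set.range c) ⊔ Ideal.span {((Scheme.ΓSpecIso (.of O)).inv ≫ r'.appTop ≫ X'.presheaf.Γgerm p).hom ϖ} =
      maximalIdeal (X'.presheaf.stalk p))
    -- the chart-`0` presentation of `𝒪_{X₁,p₁}` (B6a)
    (𝔔₁ : PrimeSpectrum (blowupAlgebra (Ideal.span (Set.range c)) (c 0)))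
    (χ₁ : blowupAlgebra (Ideal.span (Set.range c)) (c 0) →+* X₁.presheaf.stalk p₁)
    (hχ₁ : ∀ a, χ₁ (algebraMap _ _ a) = ((X'.presheaf.stalkCongr (Inseparable.of_eq hpc)).inv ≫ τ₁.stalkMap p₁).hom a)
    (hloc₁ : @IsLocalization.AtPrime _ _ (X₁.presheaf.stalk p₁) _ χ₁.toAlgebra 𝔔₁.asIdeal _)
    (h𝔔₁ : 𝔔₁.asIdeal.comap (algebraMap _ (blowupAlgebra (Ideal.span (Set.range c)) (c 0))) = maximalIdeal (X'.presheaf.stalk p))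
    (hu : ∀ l : Fin 3, l ≠ 0 → χ₁ (blowupAlgebra.frac c 0 l) ∈ maximalIdeal (X₁.presheaf.stalk p₁))
    (hreg₁ : IsRegularLocalRing (X₁.presheaf.stalk p₁))
    (hdim₁ : ringKrullDim (X₁.presheaf.stalk p₁) = ((3 + 1 : ℕ) : WithBot ℕ∞))
    -- the axis section (B6b at `C := C_axis ⊔ St K₀`)
    (sc : Spec (.of O) ⟶ X₁) (hsc : sc ≫ (τ₁ ≫ σ') ≫ q = 𝟙 _) (hscp : sc (closedPoint O) = p₁)
    (hle : J.comap τ₁ ⊔ strictTransformIdeal τ₁ J K₀ ≤ sc.ker)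
    (hker : stalkIdeal sc.ker p₁ = (Ideal.span {algebraMap _ (blowupAlgebra (Ideal.span (Set.range c)) (c 0)) (c 0)} ⊔
      Ideal.span {blowupAlgebra.frac c 0 1, blowupAlgebra.frac c 0 2}).map χ₁)
    -- the centred form (B4a)
    {d m : ℕ} (Φ : MvPolynomial (Fin 3) O) (h1m : 1 ≤ m) (hΦd : Φ.IsHomogeneous d) (hcen : ∀ α ∈ Φ.support, m ≤ α 1 + α 2)
    (hexact : ∃ α ∈ Φ.support, α 1 + α 2 = m ∧ Φ.coeff α ∉ maximalIdeal O)
    (hΦc : MvPolynomial.map (Ideal.Quotient.mk (Ideal.span (Set.range c)))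
      (MvPolynomial.map ((Scheme.ΓSpecIso (.of O)).inv ≫ r'.appTop ≫ X'.presheaf.Γgerm p).hom Φ) ≠ 0)
    (hK₀ : stalkIdeal K₀ p = Ideal.span {MvPolynomial.eval c
      (MvPolynomial.map ((Scheme.ΓSpecIso (.of O)).inv ≫ r'.appTop ≫ X'.presheaf.Γgerm p).hom Φ)})
    (Φu Φv : MvPolynomial (Fin 2) O)
    (hΦu : MvPolynomial.aeval (![1, MvPolynomial.X 0, MvPolynomial.X 0 * MvPolynomial.X 1] : Fin 3 → MvPolynomial (Fin 2) O) Φ =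
      MvPolynomial.X 0 ^ m * Φu)
    (hΦv : MvPolynomial.aeval (![1, MvPolynomial.X 0 * MvPolynomial.X 1, MvPolynomial.X 1] : Fin 3 → MvPolynomial (Fin 2) O) Φ =
      MvPolynomial.X 1 ^ m * Φv)
    (hregu : ∀ (Q : Ideal (MvPolynomial (Fin 2) O ⧸ Ideal.span {Φu})) [Q.IsPrime],
      Ideal.Quotient.mk (Ideal.span {Φu}) (MvPolynomial.C ϖ : MvPolynomial (Fin 2) O) ∈ Q → IsRegularLocalRing (Localization.AtPrime Q))
    (hregv : ∀ (Q : Ideal (MvPolynomial (Fin 2) O ⧸ Ideal.span {Φv})) [Q.IsPrime],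
      Ideal.Quotient.mk (Ideal.span {Φv}) (MvPolynomial.C ϖ : MvPolynomial (Fin 2) O) ∈ Q → IsRegularLocalRing (Localization.AtPrime Q)) :
    CentredPackage O P q X₁ (τ₁ ≫ σ') (J.comap τ₁) (strictTransformIdeal τ₁ J K₀) p₁ := by
  classical
  -- notation: `ι : O → 𝒪_{X′,p}` the structure germs
  set ι : O →+* X'.presheaf.stalk p := ((Scheme.ΓSpecIso (.of O)).inv ≫ r'.appTop ≫ X'.presheaf.Γgerm p).hom with hι
  haveI : IsDomain (X'.presheaf.stalk p ⧸ Ideal.span (Set.range c)) := MulEquiv.isDomain O θR.toMulEquiv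
  -- the frame `c′ = (χ₁(c₀/1), χ₁(c₁/c₀), χ₁(c₂/c₀))` at `p₁`
  let u : Fin 2 → X₁.presheaf.stalk p₁ := fun l => χ₁ (blowupAlgebra.frac c 0 l.succ)
  let c' : Fin 3 → X₁.presheaf.stalk p₁ := fun i => Fin.cases (χ₁ (algebraMap _ _ (c 0))) u i
  have hc'0 : c' 0 = χ₁ (algebraMap _ _ (c 0)) := rfl
  have hc'succ : ∀ l : Fin 2, c' l.succ = χ₁ (blowupAlgebra.frac c 0 l.succ) := fun l => rfl
  have hspan : Ideal.span (Set.range c') = stalkIdeal sc.ker p₁ := by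
    rw [hker, Ideal.map_sup, Ideal.map_span, Ideal.map_span, Set.image_singleton, Set.image_pair, span_range_cases_three]
    rfl
  -- the frame clauses from the section (res-type-100 `exists_sectionFrame_of_span_eq_forall_at`)
  have hdim₁' : ringKrullDim (X₁.presheaf.stalk p₁) = (3 + 1 : ℕ) := hdim₁
  obtain ⟨θ', hc'qr, hdom', -, h𝔪', hϖ'⟩ :=
    exists_sectionFrame_of_span_eq_forall_at O ((τ₁ ≫ σ') ≫ q) sc hsc p₁ hscp hreg₁ ϖ hϖ c' hspan hdim₁'
  have hdim₁'' : ringKrullDim (X₁.presheaf.stalk p₁) = (2 + 2 : ℕ) := hdim₁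
  have htail : IsQuasiRegular fun l : Fin 2 => Ideal.Quotient.mk (Ideal.span {c' 0}) (c' l.succ) :=
    isQuasiRegular_tail_of_sup_span_singleton_eq c' _ h𝔪' hdim₁''
  -- the stalks of the carrier and of the cone (res-type-100 F2′)
  have hιΦd : (MvPolynomial.map ι Φ).IsHomogeneous d := hΦd.map ι
  obtain ⟨hE, hSt, -, -⟩ := stalkIdeal_carrierDelta_of_presentation (τ := τ₁) K₀ p₁ p hpc hpJ c hcJ hc
    (MvPolynomial.map ι Φ) hιΦd hΦc hK₀ 0 𝔔₁ χ₁ hχ₁ hloc₁ h𝔔₁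
  -- the regrouped cone form `Φ′`
  have hu' : ∀ l : Fin 2, u l ∈ maximalIdeal (X₁.presheaf.stalk p₁) := fun l => hu l.succ (Fin.succ_ne_zero l)
  have hexact' : ∃ α ∈ Φ.support, α 1 + α 2 = m ∧
      IsUnit ((χ₁.comp ((algebraMap (X'.presheaf.stalk p) (blowupAlgebra (Ideal.span (Set.range c)) (c 0))).comp ι))
        (Φ.coeff α)) := by
    obtain ⟨α, hα, hαm, hαu⟩ := hexact
    exact ⟨α, hα, hαm, (IsLocalRing.notMem_maximalIdeal.mp hαu).map _⟩
  obtain ⟨Φ', hΦ'd, hΦ'eval, hΦ'𝔪⟩ := exists_regroup_centred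
    (χ₁.comp ((algebraMap (X'.presheaf.stalk p) (blowupAlgebra (Ideal.span (Set.range c)) (c 0))).comp ι)) u hu' Φ hΦd hcen hexact'
  -- `Φ′(u) = χ₁ (Φ_R(c/c₀))`
  have hfun : (fun i => χ₁ (blowupAlgebra.frac c 0 i)) = (![1, u 0, u 1] : Fin 3 → X₁.presheaf.stalk p₁) := by
    funext i
    refine Fin.cases ?_ (fun l => ?_) i
    · rw [show blowupAlgebra.frac c 0 0 = 1 from blowupAlgebra.gen_self _ _ _, map_one]
      rfl
    · have hl : l = 0 ∨ l = 1 := by fin_cases l <;> simp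
      rcases hl with rfl | rfl <;> rfl
  have hcone : MvPolynomial.eval u Φ' = χ₁ (MvPolynomial.aeval (blowupAlgebra.frac c 0) (MvPolynomial.map ι Φ)) := by
    rw [hΦ'eval, MvPolynomial.map_aeval, MvPolynomial.eval₂Hom_map_hom, hfun, MvPolynomial.aeval_def, MvPolynomial.eval₂_map,
      MvPolynomial.coe_eval₂Hom]
    exact congrArg (fun F => MvPolynomial.eval₂ F (![1, u 0, u 1] : Fin 3 → X₁.presheaf.stalk p₁) Φ) (RingHom.ext fun _ => rfl)
  have hK : stalkIdeal (strictTransformIdeal τ₁ J K₀) p₁ = Ideal.span {MvPolynomial.eval (fun l : Fin 2 => c' l.succ) Φ'} := by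
    rw [hSt, show (fun l : Fin 2 => c' l.succ) = u from rfl, hcone]
  -- `Φ′ mod (c′) ≠ 0` from `Φ′ mod 𝔪 ≠ 0`
  have hΦ'c : MvPolynomial.map (Ideal.Quotient.mk (Ideal.span (Set.range c'))) Φ' ≠ 0 :=
    map_quotient_ne_zero_of_map_residue_ne_zero Φ' hΦ'𝔪 _
      (fun h => hϖ' (by rw [h]; exact Submodule.mem_top))
  -- the lift `Φ_R = ι_* Φ` reduces to `Φ` along `θR`, and `θR (ι ϖ) = ϖ`, `ι ϖ ∈ 𝔪_R`
  have hΦR : MvPolynomial.map (θR.toRingHom.comp (Ideal.Quotient.mk (Ideal.span (Set.range c)))) (MvPolynomial.map ι Φ) = Φ := by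
    have hF : (θR.toRingHom.comp (Ideal.Quotient.mk (Ideal.span (Set.range c)))).comp ι = RingHom.id O :=
      RingHom.ext fun b => hθR b
    rw [MvPolynomial.map_map, hF, MvPolynomial.map_id]
  have hϖR : ι ϖ ∈ maximalIdeal (X'.presheaf.stalk p) := by
    rw [← h𝔪R]
    exact Ideal.mem_sup_right (Ideal.mem_span_singleton_self _)
  -- Δ-regularity after the blow-up of the section: B7
  have hΔ : ConeDeltaRegular c' Φ' :=
    coneDeltaRegular_of_chartPresentation c hc θR χ₁ 𝔔₁.asIdeal hloc₁ h𝔔₁ c' hc'0 hc'succ _ h𝔪' hdim₁'' Φ' hΦ'd hΦ'𝔪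
      (MvPolynomial.map ι Φ) Φ hΦR (by change Ideal.Quotient.mk _ (MvPolynomial.eval u Φ') = _; rw [hcone]) (ι ϖ) hϖR ϖ (hθR ϖ)
      Φu Φv hΦu hΦv hregu hregv
  -- assemble the package
  exact ⟨sc, hsc, hscp, hle, c', m, Φ', hspan, hc'qr, hdom', htail, hE, h1m, hΦ'd, hK, hΦ'c, hΦ'𝔪, hΔ⟩

end Summit.ResolutionOfSingularities.ResolutionOfSingularities.Cruxes.EquisingularLiftNat.Sections.TCPlus

end
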